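import Summits.HodgeConjecture.HodgeConjecture.Theses.KulikovCuspKugaSatake
import Summits.HodgeConjecture.HodgeConjecture.Theorems.NoetherLefschetzOneUpMiddleReduction
import Literature.AlgebraicGeometry.Motives.SegreEmbedding

/-!
# Birth skeleton (BC3) of the crux `SectorComplement` — route `KulikovCuspKugaSatake`

Crux item `stmt-HodgeConjecture-18399` (rank 3, declared RESIDUAL of a sector route), decl
`Summit.HodgeConjecture.HodgeConjecture.Theses.KulikovCuspKugaSatake.SectorComplement`:

  `SectorComplement := KugaSatakeWittTwo → _root_.HodgeConjecture`

where `KugaSatakeWittTwo := ∀ B : BettiHodgeData ℂ, B.IsClassical → ∀ r, B.IsKSCAlgebraicAtRank r`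
is the route's SECTOR (the Kuga–Satake correspondence of every complex projective K3 surface whose
rational transcendental lattice contains an isotropic plane is algebraic, in operator form, for the
classical Betti–Hodge datum). Registrar skeleton (`skeleton-register`, planner one-shot
`planner-skel-stmt-HodgeConjecture-18399-0`, 2026-08-17). The workfile directory
`Cruxes/SectorComplement/` is SHARED with the homonymous residual cruxes of NikulinTwinTransport
(stmt-13684), EndoscopicMiddleDegree (stmt-14353) and EisensteinMiddleThird (stmt-14414); this file is
the birth skeleton of stmt-18399 only (it concludes the KulikovCuspKugaSatake decl BY NAME).

## Anatomy of the crux (where the sector acts, and where it does not)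

The route header names the content of this item: "HC off the sector (abelian type in general, Weil
classes, hypersurfaces); implied by HC, used toward HC, never provable alone". The Kuga–Satake
sector acts on the Hodge conjecture in exactly ONE way: it makes the transcendental motive of a
sector K3 surface a direct summand of the motive of an abelian variety BY AN ALGEBRAIC
CORRESPONDENCE (`κ_S ⊆ O_S` algebraic on `S × A × A`), so every Hodge class generated by sector K3
surfaces is transported to an abelian variety and back. Hence, GRANTED the Hodge conjecture for
abelian varieties, the sector yields HC for products `S × S'` of sector K3 surfaces — and these are
FOURFOLDS, i.e. they sit exactly at the first open level of the tree's proved middle-degree ladder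
(`Theorems.middleReduction_proof`: HC for all `X`, all `p` ⇐ the middle degree `(m,m)` of all smooth
projective `2m`-folds; levels `m = 0, 1` are `algebraicClasses_zero` and Lefschetz (1,1),
`NoetherLefschetzOneUp.LefschetzOneOne_holds`). The skeleton cuts along these lines:

* `stub_abelianHodge` — `AbelianHodge`: the Hodge conjecture for every complex abelian variety
  (VERBATIM the existing crux `PadicSemiregularLift.HodgeAbelianVarieties`, stmt-HodgeConjecture-1333,
  which has its own lines under `Cruxes/HodgeAbelianVarieties/`). OPEN (Weil classes; abelian
  fourfolds are Markman's theorem, arXiv:2509.23403). The abelian side of the complement and the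
  landing place of everything the sector transports.
* `stub_kugaSatakeDescent` — `KugaSatakeDescent`: for every classical datum `B` in which the sector
  holds (`∀ r, B.IsKSCAlgebraicAtRank r`), `AbelianHodge` implies `HodgeConjectureFor 4 (S ⊗ S')` for
  all complex projective K3 surfaces `S, S'` whose `T(S)_ℚ, T(S')_ℚ` contain isotropic planes.
  THEOREM-GRADE CONDITIONAL (the only place `KugaSatakeWittTwo` is load-bearing): a Hodge class in
  `T(S) ⊗ T(S') ⊂ H⁴(S × S')` is a morphism of Hodge structures `φ : T(S)_ℚ → T(S')_ℚ`
  (Shafarevich's / Mukai's question; algebraic for Hodge ISOMETRIES by Mukai–Nikulin–Buskin–Huybrechts,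
  open for non-isometric `φ`); `O_{S'} ∘ φ ∘ π_T = Φ ∘ O_S ∘ π_T` with `Φ ∈ Hom_HS(H²(A²), H²(A'²))`
  a Hodge class on the abelian variety `A² × A'²`, algebraic by `AbelianHodge`; one returns to `S'`
  with `O_{S'}ᵗ ∘ L^{2g'-2}`, whose composite with `O_{S'}` is a NON-ZERO (Hodge–Riemann on `H^{2,0}`)
  element `e'` of the division algebra `End_HS(T(S')_ℚ)`, inverted by a polynomial in `e'`; the
  `NS ⊗ NS'`, `H⁰ ⊗ H⁴` parts and degrees `2, 6` are Lefschetz (1,1) and exterior products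
  (`cupProduct_map_fst_map_snd_mem_algebraicClasses`); Kuga–Satake varieties exist (Kuga–Satake 1967,
  Deligne 1972). Size XL as a formalisation, no research risk. [Huybrechts2016K3 Ch. 4 §2.6,
  Ch. 16 §3; vanGeemen2000KugaSatakeHC §10; Floccari2026 §3.3]
* `stub_fourfoldsGrantedAbelianAndSector` — `FourfoldsGrantedAbelianAndSector`: granted `AbelianHodge`
  AND HC for all sector K3 pairs (the output of the descent, for every classical datum), every
  rational `(2,2)`-class on every smooth projective complex FOURFOLD is algebraic (level 2 of the
  ladder). OPEN, conjecture-grade: the residual proper at level 2 — `(2,2)` on fourfolds of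
  non-abelian, non-`K3 × K3` type (general type, Calabi–Yau and hyperkähler fourfolds, Fano beyond
  the uniruled/cubic cases). It is `Cruxes/AbelianComplement/Lines/birth.lean`'s stub
  `FourfoldsGrantedAbelian` weakened by exactly the sector's contribution.
  [Deligne2000; ConteMurre1978; Zucker1977; arXiv:2509.23403]
* `stub_ladderGrantedAbelian` — `LadderGrantedAbelian`: for every `m ≥ 3`, granted `AbelianHodge` and
  the middle degrees of all smooth projective `2m'`-folds for every `m' < m`, every rational
  `(m,m)`-class on every smooth projective `2m`-fold is algebraic. OPEN, conjecture-grade, in LADDER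
  form (no floor, hence not summit-equivalent on its own); VERBATIM (up to the spelling of
  `AbelianHodge` as stmt-1333) the registered stub `LadderGrantedAbelian` of
  `Cruxes/AbelianComplement/Lines/birth.lean` — the sector has nothing to say above level 2 that the
  descent has not already said. [BrosnanFangNiePearlstein2009 Lemma 48; Deligne2000]
* `SectorComplement_of` (no `sorry`): from the four stubs (as name-keyed hypotheses) to the crux BY
  NAME — the sector hypothesis `hK : KugaSatakeWittTwo` and `AbelianHodge` feed the descent, whose
  output is the second hypothesis of the level-2 stub; strong induction on the level `m` (floor
  `m = 0, 1` by the tree theorems, `m = 2` stub 3, `m ≥ 3` stub 4), then `middleReduction_proof` and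
  `HodgeModels_holds`.

`sorry` occurs only inside the four `stub_*` theorems.

## Honesty box

* The crux is residual (summit-grade by declaration) and no skeleton changes that: stubs 1, 3, 4
  are open fragments of HC (each a consequence of `HodgeConjecture` by specialisation, none
  refutable short of `¬HodgeConjecture`); stub 2 is the one provable piece and the one place the
  sector is consumed. Neither stub alone gives the crux or the summit by a cheap tactic: stub 1 says
  nothing off abelian varieties, stub 2 nothing off sector K3 pairs, stub 3 nothing above dimension
  4, stub 4 has no floor (BC3 probes in the registrar folder `bc/`, quoted in `Lines/birth.md`).
* Why not the two-piece bridge `AbelianHodge ∧ (AbelianHodge → KugaSatakeWittTwo → HC)`: it would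
  hide the only theorem the sector buys (stub 2) inside a summit-grade implication; why not the
  D10-style dedup onto `AnchorTransport` (VariationalHodge ∧ AnchorExistence): it discards the
  sector hypothesis altogether. The present cut keeps `KugaSatakeWittTwo` load-bearing (stub 2),
  dedups its abelian side onto stmt-1333 verbatim, and shares its ladder tail with AbelianComplement.
* Disproof used: none relevant — `Cruxes/SectorComplement/Disproof.lean` (56 kB) is the standing
  disprover's file for stmt-13684 (`NikulinTwinTransport.SectorComplement := SquareHodgeOfSqrtTwo →
  HC`), a different decl; no `Theorems/SectorComplement/Negative/` lemma mentions
  `KulikovCuspKugaSatake`; `ledger negatives --problem HodgeConjecture` has no statement equal or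
  trivially equivalent to any stub.
-/

set_option linter.dupNamespace false

namespace Summit.HodgeConjecture.HodgeConjecture.Cruxes.SectorComplement.Birth

open CategoryTheory MonoidalCategory
open Literature.AlgebraicGeometry.Motives Literature.AlgebraicGeometry.HodgeTheory
open Literature.AlgebraicGeometry.Surfaces (IsK3Surface)
open Summit.HodgeConjecture.HodgeConjecture.Theses.NoetherLefschetzOneUp (HodgeModels_holds
  LefschetzOneOne_holds)
open Summit.HodgeConjecture.HodgeConjecture.Theses.KulikovCuspKugaSatake (KugaSatakeWittTwo
  SectorComplement)

/-! ## §1 Statements -/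

/-- The Hodge conjecture for every complex abelian variety — VERBATIM the crux
`PadicSemiregularLift.HodgeAbelianVarieties` (stmt-HodgeConjecture-1333). [Deligne2000; Andre1996] -/
def AbelianHodge : Prop :=
  ∀ A : AbelianVariety ℂ, HodgeConjectureFor A.dim A.X

/-- Level `m` of the middle-degree ladder: every rational `(m,m)`-class on every smooth projective
complex `2m`-fold is algebraic (the antecedent of `NoetherLefschetzOneUp.MiddleReduction`, one level at
a time; same spelling as `Cruxes/AbelianComplement/Lines/birth.lean`). [BrosnanFangNiePearlstein2009, Lemma 48] -/
def MiddleLevel (m : ℕ) : Prop :=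
  ∀ ⦃X : SchemeOver ℂ⦄, IsSmoothProjective (2 * m) X → ∀ c : complexBetti X (2 * m),
    IsRationalClass c → IsOfHodgeType (2 * m) X (2 * m) m m c → c ∈ algebraicClasses X m

/-- HC for the products of SECTOR K3 pairs, relative to a Betti–Hodge datum `B` (which supplies the
notion "`T(S)_ℚ` contains an isotropic plane"): for all complex projective K3 surfaces `S, S'` with
`B.HasIsotropicPlane` (Witt index 2; automatic for Picard number `≤ 15`), the Hodge conjecture holds
for the fourfold `S ⊗ S'` on the real carriers. Equivalently (Künneth + Lefschetz (1,1)): every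
morphism of Hodge structures `T(S)_ℚ → T(S')_ℚ` is algebraic. [Huybrechts2016K3, Ch. 16 §3; Deligne2000] -/
def SectorK3PairsHodge (B : BettiHodgeData ℂ) : Prop :=
  ∀ (S S' : SchemeOver ℂ) (hS : IsK3Surface S) (hS' : IsK3Surface S'),
    B.HasIsotropicPlane hS.isSmoothProjective → B.HasIsotropicPlane hS'.isSmoothProjective →
      HodgeConjectureFor 4 (S ⊗ S')

/-- STUB 2 statement — KUGA–SATAKE DESCENT (theorem-grade conditional; the one place the sector is
load-bearing): for every CLASSICAL Betti–Hodge datum `B` in which the Kuga–Satake correspondence of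
every sector K3 surface is algebraic (`∀ r, B.IsKSCAlgebraicAtRank r`, i.e. `KugaSatakeWittTwo` at
`B`), the Hodge conjecture for abelian varieties implies HC for every product of two sector K3
surfaces. [Huybrechts2016K3 Ch. 4 §2.6 and Ch. 16 §3; vanGeemen2000KugaSatakeHC §10; Floccari2026 §3.3] -/
def KugaSatakeDescent : Prop :=
  ∀ B : BettiHodgeData ℂ, B.IsClassical → (∀ r : ℕ, B.IsKSCAlgebraicAtRank r) → AbelianHodge →
    SectorK3PairsHodge B

/-- STUB 3 statement — FOURFOLDS GRANTED ABELIAN VARIETIES AND THE SECTOR PAIRS (level 2 of the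
ladder; the residual proper in dimension 4): `AbelianHodge` and HC for all sector K3 pairs (for every
classical datum) imply that every rational `(2,2)`-class on every smooth projective complex fourfold
is algebraic. [Deligne2000; ConteMurre1978; Zucker1977; arXiv:2509.23403] -/
def FourfoldsGrantedAbelianAndSector : Prop :=
  AbelianHodge → (∀ B : BettiHodgeData ℂ, B.IsClassical → SectorK3PairsHodge B) → MiddleLevel 2

/-- STUB 4 statement — THE LADDER FROM SIXFOLDS ON, GRANTED ABELIAN VARIETIES (conditional ladder
form; verbatim the registered stub of `Cruxes/AbelianComplement/Lines/birth.lean` up to the spelling of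
`AbelianHodge`): for `m ≥ 3`, `AbelianHodge` together with the middle degrees of all smooth projective
`2m'`-folds for every `m' < m` imply the middle degree `(m,m)` of every smooth projective `2m`-fold.
[BrosnanFangNiePearlstein2009 Lemma 48; Deligne2000] -/
def LadderGrantedAbelian : Prop :=
  ∀ m : ℕ, 3 ≤ m → AbelianHodge → (∀ m' : ℕ, m' < m → MiddleLevel m') → MiddleLevel m

/-! ## §2 The stubs (the ONLY `sorry`s of this file) -/

/-- STUB 1 (registered): the Hodge conjecture for complex abelian varieties (= stmt-1333). OPEN. -/
theorem stub_abelianHodge : AbelianHodge := by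
  sorry

/-- STUB 2 (registered): Kuga–Satake descent for sector K3 pairs. THEOREM-GRADE, unformalised. -/
theorem stub_kugaSatakeDescent : KugaSatakeDescent := by
  sorry

/-- STUB 3 (registered): `(2,2)` on fourfolds granted abelian varieties and sector K3 pairs. OPEN. -/
theorem stub_fourfoldsGrantedAbelianAndSector : FourfoldsGrantedAbelianAndSector := by
  sorry

/-- STUB 4 (registered): the middle-degree ladder from sixfolds on, granted abelian varieties. OPEN. -/
theorem stub_ladderGrantedAbelian : LadderGrantedAbelian := by
  sorry

/-! ### Name-keyed aliases (the skeleton audit admits a hypothesis of `SectorComplement_of` iff the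
head constant of its type is a registered obligation or has the short name of a declared stub;
device of `Cruxes/AlgebraicDensity/Lines/birth.lean`, `Cruxes/AbelianComplement/Lines/birth.lean`) -/
namespace Registered

/-- Alias of `AbelianHodge` keyed by the registered stub name. -/
abbrev stub_abelianHodge : Prop := AbelianHodge
/-- Alias of `KugaSatakeDescent` keyed by the registered stub name. -/
abbrev stub_kugaSatakeDescent : Prop := KugaSatakeDescent
/-- Alias of `FourfoldsGrantedAbelianAndSector` keyed by the registered stub name. -/
abbrev stub_fourfoldsGrantedAbelianAndSector : Prop := FourfoldsGrantedAbelianAndSector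
/-- Alias of `LadderGrantedAbelian` keyed by the registered stub name. -/
abbrev stub_ladderGrantedAbelian : Prop := LadderGrantedAbelian

end Registered

/-! ## §3 Composition (no `sorry` below this line) -/

/-- **The four stubs imply the crux, BY NAME.** Given the sector `hK : KugaSatakeWittTwo`, a smooth
projective `n`-fold `X`: the descent (stub 2), fed with `hK B hB` and `AbelianHodge` (stub 1), gives HC
for all sector K3 pairs in every classical datum; every level of the middle-degree ladder then holds
by strong induction on `m` — `m = 0` (`algebraicClasses_zero`), `m = 1` (Lefschetz (1,1),
`LefschetzOneOne_holds`), `m = 2` (stub 3 with stub 1 and the descent output), `m ≥ 3` (stub 4 with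
stub 1 and the induction hypothesis); BFNP's reduction to the middle degree
(`Theorems.middleReduction_proof`) gives every `(p,p)`-class on `X`, and `HodgeModels_holds` the
anti-vacuity conjunct of `HodgeConjectureFor n X`. -/
theorem SectorComplement_of (h₁ : Registered.stub_abelianHodge)
    (h₂ : Registered.stub_kugaSatakeDescent) (h₃ : Registered.stub_fourfoldsGrantedAbelianAndSector)
    (h₄ : Registered.stub_ladderGrantedAbelian) :
    Summit.HodgeConjecture.HodgeConjecture.Theses.KulikovCuspKugaSatake.SectorComplement := by
  unfold Summit.HodgeConjecture.HodgeConjecture.Theses.KulikovCuspKugaSatake.SectorComplement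
  intro hK n X hX
  -- the sector, through the descent, granted abelian varieties: HC for all sector K3 pairs
  have hpairs : ∀ B : BettiHodgeData ℂ, B.IsClassical → SectorK3PairsHodge B :=
    fun B hB ↦ h₂ B hB (hK B hB) h₁
  -- every level of the middle-degree ladder, by strong induction on `m`
  have hmid : ∀ m : ℕ, MiddleLevel m := by
    intro m
    induction m using Nat.strong_induction_on with
    | _ m ih =>
      obtain hm | hm := Nat.lt_or_ge m 3
      · interval_cases m
        · -- level 0: `N⁰ H⁰ = H⁰`
          intro Y _ c _ _
          rw [algebraicClasses_zero]
          exact Submodule.mem_top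
        · -- level 1: Lefschetz (1,1) (tree theorem)
          exact fun Y hY c hc hpp ↦ LefschetzOneOne_holds hY c hc hpp
        · -- level 2: stub 3, granted abelian varieties and the sector pairs
          exact h₃ h₁ hpairs
      · -- level ≥ 3: stub 4, granted abelian varieties and all lower levels
        exact h₄ m hm h₁ ih
  -- conjunct 1: Hodge models (tree theorem); conjunct 2: BFNP reduction to the middle degree
  exact ⟨HodgeModels_holds hX,
    Summit.HodgeConjecture.HodgeConjecture.Theorems.middleReduction_proof
      (fun m Y hY c hc hpp ↦ hmid m hY c hc hpp) hX⟩

/-- **The crux, closed modulo exactly the four registered stubs** (wiring check: the stubs compose as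
stated; conditional on the `stub_*` placeholders until they are proved). -/
theorem SectorComplement_of_stubs :
    Summit.HodgeConjecture.HodgeConjecture.Theses.KulikovCuspKugaSatake.SectorComplement :=
  SectorComplement_of stub_abelianHodge stub_kugaSatakeDescent stub_fourfoldsGrantedAbelianAndSector
    stub_ladderGrantedAbelian

/-! ## §4 Plumbing sanity (proved, no `sorry`) -/

/-- The floor of the ladder is in the tree: level `0`. -/
example : MiddleLevel 0 := by
  intro Y _ c _ _
  rw [algebraicClasses_zero]
  exact Submodule.mem_top

/-- The floor of the ladder is in the tree: level `1` (Lefschetz (1,1)). -/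
example : MiddleLevel 1 :=
  fun _ hY c hc hpp ↦ LefschetzOneOne_holds hY c hc hpp

/-- Informative converse: each of stubs 2, 3, 4 is a CONSEQUENCE of the summit by specialisation
(so none is refutable short of `¬HodgeConjecture`); for stub 2 the product of two K3 surfaces is a
smooth projective fourfold by `IsSmoothProjective.tensor_holds`. -/
example (hS : _root_.HodgeConjecture) : KugaSatakeDescent :=
  fun _ _ _ _ _ _ hK3 hK3' _ _ ↦
    hS (IsSmoothProjective.tensor_holds hK3.isSmoothProjective hK3'.isSmoothProjective)

example (hS : _root_.HodgeConjecture) : FourfoldsGrantedAbelianAndSector :=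
  fun _ _ _ hX c hc hpp ↦ (hS hX).2 2 c hc hpp

example (hS : _root_.HodgeConjecture) : LadderGrantedAbelian :=
  fun m _ _ _ _ hX c hc hpp ↦ (hS hX).2 m c hc hpp

/-- Informative: stub 1 is literally the existing crux `HodgeAbelianVarieties` (stmt-1333) — the
identity below is `Iff.rfl` once `Theses.PadicSemiregularLift` is imported (not imported here to keep
this skeleton independent of another route's file): `AbelianHodge ↔ ∀ A : AbelianVariety ℂ,
HodgeConjectureFor A.dim A.X`. -/
example : AbelianHodge ↔ ∀ A : AbelianVariety ℂ, HodgeConjectureFor A.dim A.X := Iff.rfl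

end Summit.HodgeConjecture.HodgeConjecture.Cruxes.SectorComplement.Birth
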